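import Summits.ResolutionOfSingularities.ResolutionOfSingularities.Theorems.FrobeniusLadderFInjectiveMacaulayficationReductions
import Mathlib.AlgebraicGeometry.IdealSheaf.Basic
import Mathlib.AlgebraicGeometry.AffineScheme
import HarnessLib

/-!
# Off the centre, scheme to ring: the stalk clause at the points of an affine open outside `supp J`
# gives the clause at `Γ(X, U)_P` for every prime `P ⊉ J(U)`

Support file for crux stmt-ResolutionOfSingularities-15315 (`FrobeniusLadder.FInjectiveMacaulayfication`,
line `Sketch`, lead seat c5, cycle 6, package A "E7 the global glue"): stub `stub_clauseOffCentre`.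

The crux's per-stalk clause is the conjunction "the local ring is a domain, every system of parameters
(`d = dim` elements generating an ideal with maximal radical) is a weakly regular sequence, and the
parameter ideal is Frobenius closed (inline form `y ^ (p ^ e) ∈ span {z ^ (p ^ e) | z ∈ (s)} ⇒ y ∈ (s)`)".
The chart-level blow-up glue (E6/E6′/E6″) over an affine open `U = Spec R` of the base needs the clause at
`R_P` for every prime `P` NOT containing the centre `J(U)`; the global glue E7 has it at the STALKS of the
base scheme `X` at the points of `U` outside the support of the ideal sheaf `J`. This file is the
bookkeeping between the two:

* `fromSpec_mem` — the point `x_P = U.fromSpec P` of `X` lies in `U`;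
* `fromSpec_not_mem_support` — if `¬ J(U) ≤ P` then `x_P ∉ supp J` (on `U` the support of `J` is the
  zero locus of `J(U)`, Mathlib `Scheme.IdealSheafData.mem_support_iff_of_mem`, and the preimage of that
  zero locus under `U.fromSpec` is `V(J(U)) ⊆ Spec Γ(X, U)`, Mathlib `IsAffineOpen.fromSpec_preimage_zeroLocus`);
* `stub_clauseOffCentre` — the registered form: `𝒪_{X, x_P}` is a localization of `Γ(X, U)` at `P`
  (Mathlib `IsAffineOpen.isLocalization_stalk'`, Stacks 01I2), hence ring-isomorphic to
  `Localization.AtPrime P` (`IsLocalization.algEquiv`), and the clause transports along ring isomorphisms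
  (`fiClause_of_ringEquiv` of the `Reductions` file).

Everything here is folklore bookkeeping; no definition is declared.
-/

-- single-problem summit: the doubled namespace component `ResolutionOfSingularities` is forced
set_option linter.dupNamespace false

namespace Summit.ResolutionOfSingularities.ResolutionOfSingularities.Theorems.FInjectiveMacaulayfication.ClauseOffCentre

open AlgebraicGeometry CategoryTheory Literature.AlgebraicGeometry.Resolution

/-- For an affine open `U` of a scheme `X` and a point `y` of `Spec Γ(X, U)`, the point `U.fromSpec y`
of `X` lies in `U` (the range of `fromSpec` is `U`, Mathlib `IsAffineOpen.range_fromSpec`). [folklore] -/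
theorem fromSpec_mem {X : Scheme.{0}} (U : X.affineOpens) (y : PrimeSpectrum Γ(X, U)) :
    U.2.fromSpec y ∈ (U : X.Opens) := by
  rw [← SetLike.mem_coe, ← U.2.range_fromSpec]
  exact ⟨y, rfl⟩

/-- For an affine open `U` of a scheme `X`, an ideal sheaf `J` and a prime `P` of `Γ(X, U)` NOT containing
`J(U)`, the point `x_P = U.fromSpec P` lies outside the support of `J`: on `U` the support is the zero
locus of `J(U)` (`Scheme.IdealSheafData.mem_support_iff_of_mem`), whose preimage under `U.fromSpec` is
`V(J(U))` (`IsAffineOpen.fromSpec_preimage_zeroLocus`), and `P ∈ V(J(U))` says `J(U) ≤ P`. [folklore] -/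
theorem fromSpec_not_mem_support {X : Scheme.{0}} (J : X.IdealSheafData) (U : X.affineOpens)
    (P : Ideal Γ(X, U)) [hP : P.IsPrime] (hJP : ¬ J.ideal U ≤ P) :
    U.2.fromSpec ⟨P, hP⟩ ∉ (J.support : Set X) := by
  intro hmem
  have h1 : U.2.fromSpec ⟨P, hP⟩ ∈ J.support := hmem
  rw [Scheme.IdealSheafData.mem_support_iff_of_mem (fromSpec_mem U ⟨P, hP⟩)] at h1
  have h2 : (⟨P, hP⟩ : PrimeSpectrum Γ(X, U)) ∈
      U.2.fromSpec ⁻¹' X.zeroLocus (U := U) (J.ideal U : Set Γ(X, U)) := h1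
  rw [U.2.fromSpec_preimage_zeroLocus] at h2
  have h3 : (J.ideal U : Set Γ(X, U)) ⊆ P := (PrimeSpectrum.mem_zeroLocus _ _).mp h2
  exact hJP fun f hf => h3 hf

/-- **OFF THE CENTRE, SCHEME TO RING** (registered helper stub `stub_clauseOffCentre` of line `Sketch`):
for an affine open `U` of a scheme `X` and an ideal sheaf `J`, if the stalks of `X` at the points of `U`
outside `supp J` satisfy the full clause (domain; every system of parameters weakly regular; parameter
ideals Frobenius closed, inline form), then so does `Γ(X, U)_P` for every prime `P ⊉ J(U)`: the point
`x_P = U.fromSpec P` lies in `U` and outside `supp J` (`fromSpec_not_mem_support`), the stalk `𝒪_{X, x_P}`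
is a localization of `Γ(X, U)` at `P` (`IsAffineOpen.isLocalization_stalk'`), so
`𝒪_{X, x_P} ≃+* Localization.AtPrime P` (`IsLocalization.algEquiv`), and the clause transports along
ring isomorphisms (`fiClause_of_ringEquiv`). Supplies hypothesis (a) "off `V(I)`" of the affine blow-up
glue E6/E6′/E6″ for `R = Γ(X₁, U)` from scheme-level data. [folklore] -/
theorem stub_clauseOffCentre : ∀ (p : ℕ) (X : Scheme.{0}) (J : X.IdealSheafData) (U : X.affineOpens),
    (∀ x : X, x ∈ (U : X.Opens) → x ∉ (J.support : Set X) →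
      IsDomain (X.presheaf.stalk x) ∧ ∀ d : ℕ, ringKrullDim (X.presheaf.stalk x) = d →
        ∀ s : Fin d → X.presheaf.stalk x, (Ideal.span (Set.range s)).radical.IsMaximal →
          RingTheory.Sequence.IsWeaklyRegular (X.presheaf.stalk x) (List.ofFn s) ∧
          ∀ y : X.presheaf.stalk x, (∃ e : ℕ, y ^ p ^ e ∈ Ideal.span
            ((fun z : X.presheaf.stalk x => z ^ p ^ e) ''
              (Ideal.span (Set.range s) : Set (X.presheaf.stalk x)))) → y ∈ Ideal.span (Set.range s)) →
    ∀ (P : Ideal Γ(X, U)) [P.IsPrime], ¬ J.ideal U ≤ P →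
      IsDomain (Localization.AtPrime P) ∧
      ∀ d : ℕ, ringKrullDim (Localization.AtPrime P) = d → ∀ s : Fin d → Localization.AtPrime P,
        (Ideal.span (Set.range s)).radical.IsMaximal →
          RingTheory.Sequence.IsWeaklyRegular (Localization.AtPrime P) (List.ofFn s) ∧
          ∀ y : Localization.AtPrime P, (∃ e : ℕ, y ^ p ^ e ∈ Ideal.span
            ((fun z : Localization.AtPrime P => z ^ p ^ e) ''
              (Ideal.span (Set.range s) : Set (Localization.AtPrime P)))) → y ∈ Ideal.span (Set.range s) := by
  intro p X J U h P hP hJP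
  -- the point of `U ⊆ X` corresponding to the prime `P` of `Γ(X, U)`
  have hxU : U.2.fromSpec ⟨P, hP⟩ ∈ (U : X.Opens) := fromSpec_mem U ⟨P, hP⟩
  have hxJ : U.2.fromSpec ⟨P, hP⟩ ∉ (J.support : Set X) := fromSpec_not_mem_support J U P hJP
  -- `𝒪_{X, x_P}` is the localization of `Γ(X, U)` at `P`
  letI : Algebra Γ(X, U) (X.presheaf.stalk (U.2.fromSpec ⟨P, hP⟩)) :=
    TopCat.Presheaf.algebra_section_stalk X.presheaf ⟨U.2.fromSpec ⟨P, hP⟩, hxU⟩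
  haveI : IsLocalization.AtPrime (X.presheaf.stalk (U.2.fromSpec ⟨P, hP⟩)) P :=
    U.2.isLocalization_stalk' ⟨P, hP⟩ hxU
  exact fiClause_of_ringEquiv p (IsLocalization.algEquiv P.primeCompl
    (X.presheaf.stalk (U.2.fromSpec ⟨P, hP⟩)) (Localization.AtPrime P)).toRingEquiv (h _ hxU hxJ)

end Summit.ResolutionOfSingularities.ResolutionOfSingularities.Theorems.FInjectiveMacaulayfication.ClauseOffCentre
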